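import Summits.QuantumFields.YangMills.Theorems.LuscherReductionDressedRitzPolyakovLiftTransplantStaticsLR
import HarnessLib

/-!
# Line «polyakovlift» r7 on crux `DressedRitz` (stmt-QuantumFields-20205): S-STAT (o2) beyond symmetry — both static clauses from a GRAM COMPARISON
# (the interface between the statics stub and renormalisation-group input), mixed with exact symmetric pairs

Fleet-service module of seat ym-infvol-p1 g7.  The seat's symmetry lineage (`…TransplantFlatCert` etc.) settles (o2) exactly for symmetry-separated pairs and
isolates the residual: pairs of channels in the same row of equivalent isotypes, where near-orthogonality of the dressed lifts `u_i` is renormalisation-group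
content.  This file types the INTERFACE such an RG input has to meet and proves it suffices:

* `offDiag_le_of_gramClose` — real-arithmetic core: `(1−ε)c_i² ≤ ‖u_i‖²`, `(1−ε)c_l² ≤ ‖u_l‖²`, `|⟨u_i,u_l⟩| ≤ ε c_i c_l`, `0 ≤ ε < 1` ⟹
  `|⟨u_i,u_l⟩| ≤ ε/(1−ε)·‖u_i‖‖u_l‖`;
* ★ `staticClauses_of_gramClose` — a family whose Gram matrix is `ε`-close (relative to a positive diagonal `c_i²`) to diagonal satisfies `StaticClauses k C β u`
  whenever `ε/(1−ε) ≤ C·λ`;  ★ `staticClauses_of_gramClose_or_separated` — the same with, pair by pair, EITHER a Gram bound OR `PairSeparated` (exact zero);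
* ★★ `staticsForLR_of_gramCert k` — the r7 stub text `StaticsForL (TransplantBasisLR k)` from a GRAM CERTIFICATE: for `λ` small and `L` large, every r7 basis
  admits scales `c_i > 0` with `(1 − C'λ)c_i² ≤ ‖u_i‖²` and, for each excited pair, `PairSeparated (g i) (g l)` or `|⟨u_i,u_l⟩| ≤ C'λ·c_i c_l`
  (conclusion with `C = 2C'`).

HONEST FRAMING: bookkeeping on the conditional femto rung R2b1 — the Gram certificate is exactly the RG content of S-STAT″ (o2) and is NOT proved here; not infinite
volume, not a gap, not Clay.  References: M. Lüscher, NPB 219 (1983) 233 [cite: Luscher1983, §3]; M. Lüscher, U. Wolff, NPB 339 (1990) 222 [cite: LuscherWolff1990].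
-/

set_option autoImplicit false

noncomputable section

open MeasureTheory Filter Topology Real
open Literature.MathematicalPhysics.QuantumFieldTheory (GaugeConfig Site gaugeTransform)
open scoped BigOperators

namespace Summit.QuantumFields.YangMills.Theorems.FemtoTransferGap.PolyakovLift

open Summit.QuantumFields.YangMills.Theorems.FemtoTransferGap

/-! ## §1 Real-arithmetic core -/

/-- `(1−ε)c_i² ≤ a`, `(1−ε)c_l² ≤ b`, `|x| ≤ ε·c_i c_l`, `0 ≤ ε < 1`, `c_i, c_l > 0` ⟹ `|x| ≤ ε/(1−ε)·(√a·√b)`. [folklore] -/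
theorem offDiag_le_of_gramClose {a b x ci cl ε : ℝ} (hε0 : 0 ≤ ε) (hε1 : ε < 1) (hci : 0 < ci) (hcl : 0 < cl)
    (ha : (1 - ε) * ci ^ 2 ≤ a) (hb : (1 - ε) * cl ^ 2 ≤ b) (hx : |x| ≤ ε * (ci * cl)) :
    |x| ≤ ε / (1 - ε) * (Real.sqrt a * Real.sqrt b) := by
  have h1ε : 0 < 1 - ε := by linarith
  set s : ℝ := Real.sqrt (1 - ε) with hs
  have hs0 : 0 < s := Real.sqrt_pos.mpr h1ε
  have hss : s * s = 1 - ε := Real.mul_self_sqrt h1ε.le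
  have hc : ∀ {c y : ℝ}, 0 < c → (1 - ε) * c ^ 2 ≤ y → c ≤ Real.sqrt y / s := by
    intro c y hc hy
    rw [le_div_iff₀ hs0]
    refine Real.le_sqrt_of_sq_le ?_
    calc (c * s) ^ 2 = (1 - ε) * c ^ 2 := by rw [mul_pow, ← hss]; ring
      _ ≤ y := hy
  calc |x| ≤ ε * (ci * cl) := hx
    _ ≤ ε * (Real.sqrt a / s * (Real.sqrt b / s)) :=
        mul_le_mul_of_nonneg_left (mul_le_mul (hc hci ha) (hc hcl hb) hcl.le (div_nonneg (Real.sqrt_nonneg _) hs0.le)) hε0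
    _ = ε / (1 - ε) * (Real.sqrt a * Real.sqrt b) := by
        rw [div_mul_div_comm, hss]
        ring

/-! ## §2 Static clauses from a Gram comparison -/

variable {L : ℕ} [NeZero L]

/-- ★ **Both static clauses from a Gram comparison**: scales `c_i > 0` with `(1−ε)c_i² ≤ ‖u_i‖²` and `|⟨u_i,u_l⟩| ≤ ε·c_i c_l` (`i ≠ l`), `0 ≤ ε < 1`,
`ε/(1−ε) ≤ C·λ` ⟹ `StaticClauses k C β u`. [cite: Luscher1983, §3] [cite: LuscherWolff1990] -/
theorem staticClauses_of_gramClose {k : ℕ} {β : ℝ} {u : Fin k → (GaugeConfig 3 L SU2 → ℝ)} (c : Fin k → ℝ) (hc : ∀ i, 0 < c i)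
    {ε : ℝ} (hε0 : 0 ≤ ε) (hε1 : ε < 1) (hdiag : ∀ i, (1 - ε) * c i ^ 2 ≤ l2 (u i) (u i))
    (hoff : ∀ i l : Fin k, i ≠ l → |l2 (u i) (u l)| ≤ ε * (c i * c l)) {C : ℝ} (hC : ε / (1 - ε) ≤ C * luscherLambda β L) :
    StaticClauses k C β u := by
  refine ⟨fun i => lt_of_lt_of_le (mul_pos (by linarith) (pow_pos (hc i) 2)) (hdiag i), fun i l hil => ?_⟩
  exact (offDiag_le_of_gramClose hε0 hε1 (hc i) (hc l) (hdiag i) (hdiag l) (hoff i l hil)).trans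
    (mul_le_mul_of_nonneg_right hC (mul_nonneg (Real.sqrt_nonneg _) (Real.sqrt_nonneg _)))

/-- ★ **Mixed certificate**: for the dressed lifts of a physical one-site basis, pair by pair EITHER `PairSeparated` (⟹ `⟨u_i,u_l⟩ = 0` exactly) OR the Gram bound
`|⟨u_i,u_l⟩| ≤ ε·c_i c_l`; with `(1−ε)c_i² ≤ ‖u_i‖²`, `0 ≤ ε < 1`, `ε/(1−ε) ≤ C·λ`, `0 ≤ C` ⟹ `StaticClauses k C β u`. [cite: Luscher1983, §3] [cite: LuscherWolff1990] -/
theorem staticClauses_of_gramClose_or_separated (β : ℝ) {φ : GaugeConfig 3 L SU2 → ℝ} (hvac : IsRawVacuum β φ) {k : ℕ}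
    {g : Fin k → (Cfg → ℝ)} (hg : ∀ i, IsPhys (g i)) (c : Fin k → ℝ) (hc : ∀ i, 0 < c i) {ε : ℝ} (hε0 : 0 ≤ ε) (hε1 : ε < 1)
    (hdiag : ∀ i, (1 - ε) * c i ^ 2 ≤ l2 (dressedLiftFamily β φ g i) (dressedLiftFamily β φ g i))
    (hoff : ∀ i l : Fin k, i ≠ l →
      PairSeparated (g i) (g l) ∨ |l2 (dressedLiftFamily β φ g i) (dressedLiftFamily β φ g l)| ≤ ε * (c i * c l))
    {C : ℝ} (hC0 : 0 ≤ C) (hC : ε / (1 - ε) ≤ C * luscherLambda β L) :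
    StaticClauses k C β (dressedLiftFamily β φ g) := by
  refine ⟨fun i => lt_of_lt_of_le (mul_pos (by linarith) (pow_pos (hc i) 2)) (hdiag i), fun i l hil => ?_⟩
  rcases hoff i l hil with hsep | hbound
  · have h0 : l2 (dressedLiftFamily β φ g i) (dressedLiftFamily β φ g l) = 0 :=
      (dressed_pair_eq_zero_of_pairSeparated β hvac (hg i) (hg l) hsep).1
    rw [h0, abs_zero]
    exact mul_nonneg (mul_nonneg hC0 (KTRCalibration.luscherLambda_nonneg β L)) (mul_nonneg (Real.sqrt_nonneg _) (Real.sqrt_nonneg _))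
  · exact (offDiag_le_of_gramClose hε0 hε1 (hc i) (hc l) (hdiag i) (hdiag l) hbound).trans
      (mul_le_mul_of_nonneg_right hC (mul_nonneg (Real.sqrt_nonneg _) (Real.sqrt_nonneg _)))

/-! ## §3 ★★ The r7 stub text from a Gram certificate -/

/-- ★★ **`StaticsForL (TransplantBasisLR k)` from a GRAM CERTIFICATE** (the interface S-STAT″ (o2) asks of renormalisation-group input): if there are `C' ≥ 0`,
`lam1 > 0` such that for every `0 < lam ≤ lam1` and all large `L`, every `β` in the femto window, every raw vacuum and every r7 basis `g` there are scales
`c_i > 0` with `(1 − C'λ)c_i² ≤ ‖u_i‖²` and, for each pair `i ≠ l`, `PairSeparated (g i) (g l)` or `|⟨u_i,u_l⟩| ≤ C'λ·c_i c_l` (`u = dressedLiftFamily β φ g`,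
`λ = luscherLambda β L`), then the r7 statics text holds at level `k` with `C = 2C'`. [cite: Luscher1983, §3] [cite: LuscherWolff1990] -/
theorem staticsForLR_of_gramCert (k : ℕ)
    (hgram : ∃ C' lam1 : ℝ, 0 ≤ C' ∧ 0 < lam1 ∧ ∀ lam : ℝ, 0 < lam → lam ≤ lam1 → ∃ L0 : ℕ,
      ∀ (L : ℕ) [NeZero L], L0 ≤ L → ∀ β : ℝ, InFemtoWindow lam β L → ∀ φ : GaugeConfig 3 L SU2 → ℝ, IsRawVacuum β φ →
        ∀ g : Fin k → (Cfg → ℝ), TransplantBasisLR k L (luscherLambda β L) g →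
          ∃ c : Fin k → ℝ, (∀ i, 0 < c i) ∧
            (∀ i, (1 - C' * luscherLambda β L) * c i ^ 2 ≤ l2 (dressedLiftFamily β φ g i) (dressedLiftFamily β φ g i)) ∧
            (∀ i l : Fin k, i ≠ l → PairSeparated (g i) (g l) ∨
              |l2 (dressedLiftFamily β φ g i) (dressedLiftFamily β φ g l)| ≤ C' * luscherLambda β L * (c i * c l))) :
    StaticsForL (TransplantBasisLR k) := by
  obtain ⟨C', lam1, hC', hlam1, h⟩ := hgram
  refine ⟨2 * C', min lam1 (1 / (4 * C' + 4)), by positivity, lt_min hlam1 (by positivity), fun lam hlam hle => ?_⟩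
  obtain ⟨L0, hL0⟩ := h lam hlam (hle.trans (min_le_left _ _))
  refine ⟨L0, fun L _ hL β hW φ hvac g hbasis => ?_⟩
  obtain ⟨c, hc, hdiag, hoff⟩ := hL0 L hL β hW φ hvac g hbasis
  have hΛ0 : 0 ≤ luscherLambda β L := KTRCalibration.luscherLambda_nonneg β L
  have hΛle : luscherLambda β L ≤ 2 * lam := hW.2.2
  have hlam4 : lam ≤ 1 / (4 * C' + 4) := hle.trans (min_le_right _ _)
  -- ε := C'·λ ≤ 1/2
  have hε0 : 0 ≤ C' * luscherLambda β L := mul_nonneg hC' hΛ0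
  have hεhalf : C' * luscherLambda β L ≤ 1 / 2 := by
    have h1 : C' * luscherLambda β L ≤ C' * (2 * (1 / (4 * C' + 4))) :=
      mul_le_mul_of_nonneg_left (hΛle.trans (by linarith)) hC'
    have h2 : C' * (2 * (1 / (4 * C' + 4))) ≤ 1 / 2 := by
      rw [show C' * (2 * (1 / (4 * C' + 4))) = C' / (2 * C' + 2) by field_simp; ring]
      rw [div_le_iff₀ (by positivity)]
      linarith
    exact h1.trans h2
  have hε1 : C' * luscherLambda β L < 1 := by linarith
  refine staticClauses_of_gramClose_or_separated β hvac (basisPhysL_transplantBasisLR k L _ g hbasis) c hc hε0 hε1 hdiag hoff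
    (by positivity) ?_
  -- ε/(1−ε) ≤ 2ε = (2C')·λ
  rw [div_le_iff₀ (by linarith), mul_assoc]
  nlinarith [hε0, hεhalf]

end Summit.QuantumFields.YangMills.Theorems.FemtoTransferGap.PolyakovLift

end
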